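import Summits.AtomisticToContinuum.HydrodynamicLimit.Theorems.InformationPercolationEngineChaosClosesEulerDissipationRigidityB
import HarnessLib

/-!
# Dissipation rigidity — C: Fatou on the symmetrised dissipation, detailed balance of the limit

Helper for the line `empirical-h-theorem` of the crux `InformationPercolationEngine.ChaosClosesEuler`
(stmt-AtomisticToContinuum-15141), registered stub `stub_dissipationRigidity`.

`symmetrised_eq_zero_of_dissipation_le`: if continuous `Λₖ → Λ` pointwise on `ℝ³` with `Λ` continuous,
the pair-energy cuts `Lₖ → ∞` and the cut dissipation functionals satisfy `D(Λₖ, Lₖ) ≤ ηₖ → 0`, then the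
symmetrised entropy-production integrand of the limit,
`((u−v)·ω)₊ (A − A′)(e^{A} − e^{A′})`, `A = Λ(v)+Λ(u)`, `A′ = Λ(v′)+Λ(u′)`, vanishes identically on
`ℝ³ × ℝ³ × S²`: by file B, `2 D(Λₖ, Lₖ) = ∫ Pₖ` with `Pₖ ≥ 0` the cut symmetrised integrands, which converge
pointwise to the limit integrand (the cuts exhaust); Fatou's lemma gives `∫ P_∞ ≤ liminf 2ηₖ = 0`, so the
continuous `P_∞ ≥ 0` vanishes a.e., hence everywhere since `dv du dω` charges open sets
(tree: `isOpenPosMeasure_volume_prod_sphereMeasure`).  With file B this makes `Λ` a continuous collision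
invariant, hence a quadratic polynomial `a + ⟪b, v⟫ + c|v|²` (`exists_eq_quadratic_of_dissipation_le`).

References: C. Cercignani, R. Illner, M. Pulvirenti, *The Mathematical Theory of Dilute Gases* (1994),
§3.1 Thm 3.1.1, §3.2 (3.2.4)–(3.2.6); folklore (Fatou).
-/

noncomputable section

namespace Summit.AtomisticToContinuum.HydrodynamicLimit.Theorems.ChaosClosesEulerDissipationRigidity

open scoped BigOperators Topology Classical MeasureTheory ENNReal InnerProductSpace
open Filter Set MeasureTheory
open Literature.MathematicalPhysics.KineticTheory
open Literature.Analysis.FluidPDE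
open Summit.AtomisticToContinuum.HydrodynamicLimit.Theorems

/-- The symmetrised entropy-production integrand `((u−v)·ω)₊ (A − A′)(e^{A} − e^{A′})` of a continuous `Λ`
is continuous on `ℝ³ × ℝ³ × S²`. [folklore] -/
theorem continuous_symmetrisedIntegrand {Λ : V3 → ℝ} (hΛ : Continuous Λ) :
    Continuous fun q : (V3 × V3) × Metric.sphere (0 : V3) 1 =>
      hardSphereKernel q.1.swap q.2 * ((Λ q.1.1 + Λ q.1.2 - (Λ (collide q.2 q.1).1 + Λ (collide q.2 q.1).2)) *
        (Real.exp (Λ q.1.1 + Λ q.1.2) - Real.exp (Λ (collide q.2 q.1).1 + Λ (collide q.2 q.1).2))) := by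
  have hc := continuous_collide_uncurry (E := V3)
  have h1 : Continuous fun q : (V3 × V3) × Metric.sphere (0 : V3) 1 => Λ (collide q.2 q.1).1 :=
    hΛ.comp (continuous_fst.comp hc)
  have h2 : Continuous fun q : (V3 × V3) × Metric.sphere (0 : V3) 1 => Λ (collide q.2 q.1).2 :=
    hΛ.comp (continuous_snd.comp hc)
  have h3 : Continuous fun q : (V3 × V3) × Metric.sphere (0 : V3) 1 => Λ q.1.1 := hΛ.comp (by fun_prop)
  have h4 : Continuous fun q : (V3 × V3) × Metric.sphere (0 : V3) 1 => Λ q.1.2 := hΛ.comp (by fun_prop)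
  have hB : Continuous fun q : (V3 × V3) × Metric.sphere (0 : V3) 1 => hardSphereKernel q.1.swap q.2 :=
    UkaiLanford.continuous_hardSphereKernel_uncurry.comp (continuous_swap.prodMap continuous_id)
  exact hB.mul (((h3.add h4).sub (h1.add h2)).mul ((Real.continuous_exp.comp (h3.add h4)).sub
    (Real.continuous_exp.comp (h1.add h2))))

/-- The cut symmetrised integrand is pointwise nonnegative (Boltzmann's inequality). [folklore] -/
theorem symmetrisedIntegrand_nonneg (Λ : V3 → ℝ) (L : ℝ) (q : (V3 × V3) × Metric.sphere (0 : V3) 1) :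
    0 ≤ (if ‖q.1.1‖ ^ 2 + ‖q.1.2‖ ^ 2 ≤ L then (1 : ℝ) else 0) * (hardSphereKernel q.1.swap q.2 *
        ((Λ q.1.1 + Λ q.1.2 - (Λ (collide q.2 q.1).1 + Λ (collide q.2 q.1).2)) *
          (Real.exp (Λ q.1.1 + Λ q.1.2) - Real.exp (Λ (collide q.2 q.1).1 + Λ (collide q.2 q.1).2)))) := by
  refine mul_nonneg (by split_ifs <;> norm_num) (mul_nonneg (UkaiLanford.hardSphereKernel_nonneg' _ _)
    (sub_mul_exp_sub_exp_nonneg _ _))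

/-- **Fatou on the symmetrised dissipation.** If continuous `Λₖ → Λ` pointwise (`Λ` continuous), the cuts
`Lₖ → ∞` and `D(Λₖ, Lₖ) ≤ ηₖ → 0`, then the symmetrised entropy-production integrand of `Λ` vanishes
identically on `ℝ³ × ℝ³ × S²`. [folklore] -/
theorem symmetrised_eq_zero_of_dissipation_le {Λs : ℕ → V3 → ℝ} {Λ : V3 → ℝ}
    (hc : ∀ k, Continuous (Λs k)) (hΛ : Continuous Λ)
    (hpt : ∀ v, Tendsto (fun k => Λs k v) atTop (𝓝 (Λ v))) {L η : ℕ → ℝ}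
    (hL : Tendsto L atTop atTop) (hη : Tendsto η atTop (𝓝 0))
    (hD : ∀ k, ∫ v, ∫ u, (if ‖v‖ ^ 2 + ‖u‖ ^ 2 ≤ L k then (1 : ℝ) else 0) *
      (∫ ω : Metric.sphere (0 : V3) 1, (Λs k v + Λs k u - Λs k (collide ω (v, u)).1 -
        Λs k (collide ω (v, u)).2) * hardSphereKernel (u, v) ω ∂sphereMeasure) *
          (Real.exp (Λs k v) * Real.exp (Λs k u)) ≤ η k) :
    ∀ (p : V3 × V3) (ω : Metric.sphere (0 : V3) 1),
      hardSphereKernel p.swap ω * ((Λ p.1 + Λ p.2 - (Λ (collide ω p).1 + Λ (collide ω p).2)) *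
        (Real.exp (Λ p.1 + Λ p.2) - Real.exp (Λ (collide ω p).1 + Λ (collide ω p).2))) = 0 := by
  set μ : Measure ((V3 × V3) × Metric.sphere (0 : V3) 1) :=
    ((volume : Measure V3).prod (volume : Measure V3)).prod sphereMeasure with hμ
  -- the cut symmetrised integrands and their limit
  set P : ℕ → (V3 × V3) × Metric.sphere (0 : V3) 1 → ℝ := fun k q =>
    (if ‖q.1.1‖ ^ 2 + ‖q.1.2‖ ^ 2 ≤ L k then (1 : ℝ) else 0) * (hardSphereKernel q.1.swap q.2 *
      ((Λs k q.1.1 + Λs k q.1.2 - (Λs k (collide q.2 q.1).1 + Λs k (collide q.2 q.1).2)) *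
        (Real.exp (Λs k q.1.1 + Λs k q.1.2) -
          Real.exp (Λs k (collide q.2 q.1).1 + Λs k (collide q.2 q.1).2)))) with hP
  set Pinf : (V3 × V3) × Metric.sphere (0 : V3) 1 → ℝ := fun q =>
    hardSphereKernel q.1.swap q.2 * ((Λ q.1.1 + Λ q.1.2 - (Λ (collide q.2 q.1).1 + Λ (collide q.2 q.1).2)) *
      (Real.exp (Λ q.1.1 + Λ q.1.2) - Real.exp (Λ (collide q.2 q.1).1 + Λ (collide q.2 q.1).2))) with hPinf
  have hPk : ∀ k, Integrable (P k) μ ∧ ∫ q, P k q ∂μ ≤ 2 * η k := by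
    intro k
    obtain ⟨hi, he⟩ := symmetrised_integral_eq_two_mul (hc k) (L k)
    refine ⟨hi, ?_⟩
    simp only [hP]
    rw [he]
    linarith [hD k]
  have hP0 : ∀ k q, 0 ≤ P k q := fun k q => symmetrisedIntegrand_nonneg (Λs k) (L k) q
  have hPinf0 : ∀ q, 0 ≤ Pinf q := fun q =>
    mul_nonneg (UkaiLanford.hardSphereKernel_nonneg' _ _) (sub_mul_exp_sub_exp_nonneg _ _)
  have hPm : ∀ k, AEMeasurable (fun q => ENNReal.ofReal (P k q)) μ := fun k =>
    (hPk k).1.aemeasurable.ennreal_ofReal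
  -- pointwise convergence `P k q → Pinf q` (the cuts exhaust)
  have hlim : ∀ q, Tendsto (fun k => ENNReal.ofReal (P k q)) atTop (𝓝 (ENNReal.ofReal (Pinf q))) := by
    intro q
    refine ENNReal.tendsto_ofReal ?_
    have hev : ∀ᶠ k in atTop, ‖q.1.1‖ ^ 2 + ‖q.1.2‖ ^ 2 ≤ L k := hL.eventually (eventually_ge_atTop _)
    have ha := (hpt q.1.1).add (hpt q.1.2)
    have hb := (hpt (collide q.2 q.1).1).add (hpt (collide q.2 q.1).2)
    have h1 : Tendsto (fun k => hardSphereKernel q.1.swap q.2 *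
        ((Λs k q.1.1 + Λs k q.1.2 - (Λs k (collide q.2 q.1).1 + Λs k (collide q.2 q.1).2)) *
          (Real.exp (Λs k q.1.1 + Λs k q.1.2) -
            Real.exp (Λs k (collide q.2 q.1).1 + Λs k (collide q.2 q.1).2)))) atTop (𝓝 (Pinf q)) :=
      ((ha.sub hb).mul (((Real.continuous_exp.tendsto _).comp ha).sub
        ((Real.continuous_exp.tendsto _).comp hb))).const_mul _
    refine h1.congr' ?_
    filter_upwards [hev] with k hk
    simp only [hP, if_pos hk, one_mul]
  -- Fatou: `∫⁻ Pinf ≤ liminf ∫⁻ P k ≤ liminf 2ηₖ = 0`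
  have hF : ∫⁻ q, ENNReal.ofReal (Pinf q) ∂μ = 0 := by
    have h1 : ∫⁻ q, ENNReal.ofReal (Pinf q) ∂μ = ∫⁻ q, liminf (fun k => ENNReal.ofReal (P k q)) atTop ∂μ :=
      lintegral_congr fun q => ((hlim q).liminf_eq).symm
    have h2 := lintegral_liminf_le' (μ := μ) (u := atTop) hPm
    have h3 : ∀ k, ∫⁻ q, ENNReal.ofReal (P k q) ∂μ ≤ ENNReal.ofReal (2 * η k) := by
      intro k
      rw [← ofReal_integral_eq_lintegral_ofReal (hPk k).1 (Eventually.of_forall (hP0 k))]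
      exact ENNReal.ofReal_le_ofReal (hPk k).2
    have h4 : liminf (fun k => ∫⁻ q, ENNReal.ofReal (P k q) ∂μ) atTop ≤
        liminf (fun k => ENNReal.ofReal (2 * η k)) atTop :=
      liminf_le_liminf (Eventually.of_forall h3)
    have h5 : Tendsto (fun k => ENNReal.ofReal (2 * η k)) atTop (𝓝 0) := by
      have := ENNReal.tendsto_ofReal (hη.const_mul 2)
      rwa [mul_zero, ENNReal.ofReal_zero] at this
    rw [h5.liminf_eq] at h4
    exact le_antisymm (h1.trans_le (h2.trans h4)) bot_le
  -- a.e. vanishing, then everywhere by continuity and full support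
  have hcont : Continuous Pinf := continuous_symmetrisedIntegrand hΛ
  have hae : Pinf =ᵐ[μ] 0 := by
    have h1 := (lintegral_eq_zero_iff' hcont.measurable.ennreal_ofReal.aemeasurable).1 hF
    filter_upwards [h1] with q hq
    exact le_antisymm (ENNReal.ofReal_eq_zero.1 hq) (hPinf0 q)
  haveI : μ.IsOpenPosMeasure := isOpenPosMeasure_volume_prod_sphereMeasure
  have hzero : Pinf = 0 := Measure.eq_of_ae_eq hae hcont continuous_const
  intro p ω
  have := congrFun hzero (p, ω)
  simpa only [hPinf, Pi.zero_apply] using this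

/-- **Zero dissipation in the limit forces a quadratic exponent.** Under the hypotheses of
`symmetrised_eq_zero_of_dissipation_le`, the continuous limit `Λ` is a collision invariant, hence
`Λ(v) = a + ⟪b, v⟫ + c|v|²` (Boltzmann; classification of continuous collision invariants). [folklore] -/
theorem exists_eq_quadratic_of_dissipation_le {Λs : ℕ → V3 → ℝ} {Λ : V3 → ℝ}
    (hc : ∀ k, Continuous (Λs k)) (hΛ : Continuous Λ)
    (hpt : ∀ v, Tendsto (fun k => Λs k v) atTop (𝓝 (Λ v))) {L η : ℕ → ℝ}
    (hL : Tendsto L atTop atTop) (hη : Tendsto η atTop (𝓝 0))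
    (hD : ∀ k, ∫ v, ∫ u, (if ‖v‖ ^ 2 + ‖u‖ ^ 2 ≤ L k then (1 : ℝ) else 0) *
      (∫ ω : Metric.sphere (0 : V3) 1, (Λs k v + Λs k u - Λs k (collide ω (v, u)).1 -
        Λs k (collide ω (v, u)).2) * hardSphereKernel (u, v) ω ∂sphereMeasure) *
          (Real.exp (Λs k v) * Real.exp (Λs k u)) ≤ η k) :
    ∃ (a c : ℝ) (b : V3), ∀ v, Λ v = a + ⟪b, v⟫_ℝ + c * ‖v‖ ^ 2 :=
  exists_eq_quadratic_of_symmetrised_eq_zero hΛ (symmetrised_eq_zero_of_dissipation_le hc hΛ hpt hL hη hD)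

/-! ## Registered sub-goal -/

/-- **Registered sub-goal `stub_dissipationRigidityC` (helper C of `stub_dissipationRigidity`): zero
dissipation in the limit (`D(Λₖ, Lₖ) ≤ ηₖ → 0`, `Lₖ → ∞`, `Λₖ → Λ` pointwise, all continuous) forces the
limit exponent `Λ` to be a quadratic collision invariant `a + ⟪b, v⟫ + c|v|²`.** [folklore] -/
theorem stub_dissipationRigidityC : ∀ {Λs : ℕ → V3 → ℝ} {Λ : V3 → ℝ}, (∀ k, Continuous (Λs k)) → Continuous Λ → (∀ v, Tendsto (fun k => Λs k v) atTop (𝓝 (Λ v))) → ∀ {L η : ℕ → ℝ}, Tendsto L atTop atTop → Tendsto η atTop (𝓝 0) → (∀ k, ∫ v, ∫ u, (if ‖v‖ ^ 2 + ‖u‖ ^ 2 ≤ L k then (1 : ℝ) else 0) * (∫ ω : Metric.sphere (0 : V3) 1, (Λs k v + Λs k u - Λs k (collide ω (v, u)).1 - Λs k (collide ω (v, u)).2) * hardSphereKernel (u, v) ω ∂sphereMeasure) * (Real.exp (Λs k v) * Real.exp (Λs k u)) ≤ η k) → ∃ (a c : ℝ) (b : V3), ∀ v, Λ v = a + ⟪b,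 v⟫_ℝ + c * ‖v‖ ^ 2 :=
  fun hc hΛ hpt _ _ hL hη hD => exists_eq_quadratic_of_dissipation_le hc hΛ hpt hL hη hD

end Summit.AtomisticToContinuum.HydrodynamicLimit.Theorems.ChaosClosesEulerDissipationRigidity

end
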